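import Summits.QuantumFields.YangMills.Theorems.BalabanUVNodesN18KingModelScales
import Literature.MathematicalPhysics.QuantumFieldTheory.King1986.TopScalePiece

/-!
# BalabanUVNodes ∕ N18 — the TOP-SCALE PIECE `G^η_{(K)} = C^η − G^η_K` of King's propagator decomposition (2.17) as a
# MULTI-SCALE inhabitant of `T4OutputRate.NE5` for King's ACTUAL operators on Bałaban's tori, UNCONDITIONAL — n18-b's
# files 14a–d (`King1986/CovarianceQstar*`, `TopScalePiece`: p. 675's last paragraph) consumed BY NAME, plus the two
# one-run envelopes (`DecayBound`, `κ > 0`) of the same graphs (Track A, DAG node N18 = NE5 `T4OutputRate.NE5 EA EB W κ θ C₅`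
# :211; cluster K4; the -a∕-b loop on the PRINTED MODEL, sixth display)

HONEST FRAMING.  Count-neutral kernel bookkeeping (seat pub-ymgap-dag-n18-a g5; `--supports stmt-QuantumFields-19182`).
King's A = 0 scalar MODEL of the NE5 mechanism (template literature, published and proved) — NOT Bałaban's covariant
one-step outputs `E^{(j)}(X; g, U)`, for which NE5 is NOT IN PRINT and has no tree producer (NODE O 0∕1); NOT a node
discharge; finite tori; nothing continuum ∕ ℝ⁴ ∕ OS ∕ mass-gap ∕ Clay.  THEOREMS ONLY: 0 `def`, 0 `sorry`, standard axioms.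

THE POINT.  King p. 675: «Finally, we must establish Propositions 3.7 and 3.9 for G^η_{(K)} = C^η − G^η_K … (4.44) … Finally,
Proposition 3.9 holds for G^η_{(K)} from the convergence of C^ηQ^*_K and a_KQ_KG^η_K, and the scalings of the operators.»
n18-b's `TopScalePiece` (p422394) typed it for the ACTUAL `A = 0` operators on Bałaban's volumes in block currency:
`topPiece_kernel_eq_sum` (`G^η_{(K)}(x, y) = Σ_b C^ηQ^*_K(x, b)·ℋ_K(y, b)`), `topPiece_decay_blocks` (Prop. 3.7:
`|G^η_{(K)}(x, y)| ≤ c·e^{−δ|B(x) − B(y)|}`), `topPiece_rate_blocks` (`|G^{η′}_{(K),(n)}(x′, y′) − G^η_{(K)}(x, y)| ≤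
(c√((C₁′(K,n) + C₂′)(L^K)^{−γ}) + c(L^K)⁻¹)·e^{−δ|B(x) − B(y)|}`).  The top piece is a TWO-POINT graph, so no three-factor knit
is needed: its η-rate IS an `NE5` instance once the rate constant is made `K, n`-free — §1 `topRate_le_unif`
(`c√((C₁′(K,n)+C₂′)(L^K)^{−γ}) + c(L^K)⁻¹ ≤ (c√C₅(a,L,d,γ) + c)·(L^{−γ∕2})^K`: `N18KingModel.prop38Const_le_unif`,
`(L^K)^{−γ} = ((L^{−γ∕2})^K)²`, and `(L^K)⁻¹ ≤ (L^{−γ∕2})^K` = `N18KingModelScales.inv_pow_le_kingTheta_pow`, the extra additive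
`c(L^K)⁻¹` of the top-scale row being ABSORBED by the rate).  Then:
* §2 **`ne5_kingModel_topPiece_torus`** — for `d ≥ 1`, odd `L > 1`, `a > 0`, `m² > 0`, `0 ≤ γ ≤ 1`: `∃ κ > 0, C₅ ≥ 0 (d, L, a,
  m², γ only) ∀ n ≥ 1 ∀ scale-indexed Bałaban tori L·M_K = 2L^{m_K} ∀ carriers (scale X = K ≥ 1 = run A's number of steps;
  fine points x_A, y_A under x_B, y_B; d X ≤ |B(x_A) − B(y_A)|_{T₁}) ∀ read-outs EA = G^η_{(K)}(x_A, y_A),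
  EB = G^{η′}_{(K),(n)}(x_B, y_B) ∀ W, NE5 EA EB W κ (L^{−γ∕2}) C₅` — UNCONDITIONAL, ONE θ for all K.
* §3 `decayBound_topPiece_A` ∕ `decayBound_topPiece_B` — the N10∕NODE-A face of the same graphs WITH `κ > 0`
  (`topPiece_decay_blocks` at the volumes `(d, L, m_K, K)` ∕ `(d, L, m_K, K + n)`, `blockOf_over`): contrast g2's
  `decayBound_of_kingModel_A∕_B` (`κ = 0`, sup norm only).
* §4 `ne5_kingModel_topPiece_inhabited` — §2 on LITERAL carriers (`d X` = the actual block distance).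
With g4's files 9∕11 and g5's Hölder files, every piece `G_{(j)}`, `1 ≤ j ≤ K`, of (2.17) now has its (3.73)-type η-rate as
a multi-scale `NE5` inhabitant for King's actual operators on Bałaban's tori; the `j = 0` piece (Prop. 3.7 alone, «When j = 0,
we bound each term separately», p. 675) carries no `L^{−γk}` and is not an `NE5` statement.
NOT COVERED ∕ PINS (standing, ref-B READ #66∕#73∕#110∕#238∕#263): A = 0, `g`∕`U` unread; periodic b.c.; King's rescaling (2.20);
the Hölder ∕ derivative lines of Prop. 3.9 FOR `G^η_{(K)}` and the `t`-derivative clauses (3.74)–(3.75) through `m²(t)` (n18-b's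
NOT COVERED list); the bearing on Bałaban's `E^{(j)}(X; g, U)` is NIL (NODE O + rows NE2∕NE3, seat README «No tree producer»).

Sources: C. King, Commun. Math. Phys. **102** (1986) 649–677 [King1986] — p. 675 (4.44)–(4.45), (2.17) p. 653, Prop. 3.7
(3.64) p. 663, Prop. 3.8 (3.71) p. 664, Prop. 3.9 (3.73) p. 665; T. Bałaban, Commun. Math. Phys. **109** (1987) 249–301
[Balaban1987RG1] — (0.25) p. 257, Thm 1 p. 259 (uniformity in ε, the only printed trace of NE5).  No claim about the mass gap.
-/

noncomputable section

namespace Summit.QuantumFields.YangMills.BalabanUVNodes.N18KingModelTopPiece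

open Real Matrix
open Literature.MathematicalPhysics.QuantumFieldTheory.Balaban1983to89 (Params)
open Literature.MathematicalPhysics.QuantumFieldTheory.Balaban1983to89.T4OutputRate (Carriers Functional NE5 DecayBound)
open Literature.MathematicalPhysics.QuantumFieldTheory.Balaban1983to89.B5Prop11Plancherel (Tor fine)
open Literature.MathematicalPhysics.QuantumFieldTheory.King1986
  (aK lemma43Const prop38RateConst prop38PosConst exp_decay_mono)
open Literature.MathematicalPhysics.QuantumFieldTheory.King1986.Torus
  (topPiece blockOf blockOf_over tdistT tdistT_nonneg topPiece_decay_blocks topPiece_rate_blocks)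
open Summit.QuantumFields.YangMills.BalabanUVNodes.N18KingModel
  (prop38Const_le_unif prop38Const_unif_nonneg rpow_neg_natPow kingTheta_pos kingTheta_eq_sq coarse_val)
open Summit.QuantumFields.YangMills.BalabanUVNodes.N18KingModelScales (inv_pow_le_kingTheta_pow)

variable {d : ℕ}

/-! ## §1 The top-scale rate constant, uniform in `K` and `n`; the additive `c(L^K)⁻¹` absorbed by the rate -/

/-- **One rate constant for all scales (top piece).**  n18-b's two-spacing rate factor of `G^η_{(K)}`
(`topPiece_rate_blocks`), `c√((C₁′(K,n) + C₂′)(L^K)^{−γ}) + c(L^K)⁻¹`, is at most `(c√C₅(a,L,d,γ) + c)·(L^{−γ∕2})^K` with the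
`K, n`-free `C₅` of `N18KingModel.prop38Const_le_unif` — `(L^K)^{−γ} = ((L^{−γ∕2})^K)²` and `(L^K)⁻¹ ≤ (L^{−γ∕2})^K`
(`γ ≤ 2`). [cite: King1986, p.675, Prop. 3.8 (3.71) p.664, Lemma 4.3 p.672] -/
theorem topRate_le_unif (hd : 0 < d) {a : ℝ} (ha : 0 < a) {L : ℕ} (hL : 2 ≤ L) {K n : ℕ} (hK : 1 ≤ K) (hn : 1 ≤ n)
    {γ : ℝ} (hγ1 : γ ≤ 1) {c : ℝ} (hc : 0 ≤ c) :
    c * Real.sqrt ((prop38RateConst a a (lemma43Const a L K n) ((π ^ 2 / 4) ^ d) d γ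
          + prop38PosConst a ((π ^ 2 / 4) ^ d) d γ) * ((L ^ K : ℕ) : ℝ) ^ (-γ))
        + c * ((L : ℝ) ^ K)⁻¹
      ≤ (c * Real.sqrt (prop38RateConst a a (a * (2 * ((a * (1 - ((L : ℝ) ^ 2)⁻¹))⁻¹ + π ^ 2 / 48 + 1 / 3)))
                ((π ^ 2 / 4) ^ d) d γ + prop38PosConst a ((π ^ 2 / 4) ^ d) d γ) + c)
          * (((L : ℝ) ^ (-(γ / 2))) ^ K) := by
  have hL1 : 1 ≤ L := by omega
  set s : ℝ := (L : ℝ) ^ (-(γ / 2)) with hs_def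
  have hs : 0 ≤ s := Real.rpow_nonneg (Nat.cast_nonneg _) _
  have hrate : ((L ^ K : ℕ) : ℝ) ^ (-γ) = (s ^ K) ^ 2 := by
    rw [rpow_neg_natPow, kingTheta_eq_sq, ← pow_mul, ← pow_mul, mul_comm]
  set Ck : ℝ := prop38RateConst a a (lemma43Const a L K n) ((π ^ 2 / 4) ^ d) d γ
    + prop38PosConst a ((π ^ 2 / 4) ^ d) d γ with hCk
  set Cu : ℝ := prop38RateConst a a (a * (2 * ((a * (1 - ((L : ℝ) ^ 2)⁻¹))⁻¹ + π ^ 2 / 48 + 1 / 3)))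
      ((π ^ 2 / 4) ^ d) d γ + prop38PosConst a ((π ^ 2 / 4) ^ d) d γ with hCu
  have hCle : Ck ≤ Cu := prop38Const_le_unif hd ha hL hK hn (by linarith)
  have h1 : Real.sqrt (Ck * ((L ^ K : ℕ) : ℝ) ^ (-γ)) = Real.sqrt Ck * s ^ K := by
    rw [hrate, Real.sqrt_mul' _ (sq_nonneg _), Real.sqrt_sq (pow_nonneg hs _)]
  have h2 : Real.sqrt Ck ≤ Real.sqrt Cu := Real.sqrt_le_sqrt hCle
  have h3 : ((L : ℝ) ^ K)⁻¹ ≤ s ^ K := inv_pow_le_kingTheta_pow hL1 (by linarith : γ / 2 ≤ 1) K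
  have hsK : 0 ≤ s ^ K := pow_nonneg hs _
  rw [h1]
  calc c * (Real.sqrt Ck * s ^ K) + c * ((L : ℝ) ^ K)⁻¹
      ≤ c * (Real.sqrt Cu * s ^ K) + c * s ^ K :=
        add_le_add (mul_le_mul_of_nonneg_left (mul_le_mul_of_nonneg_right h2 hsK) hc)
          (mul_le_mul_of_nonneg_left h3 hc)
    _ = (c * Real.sqrt Cu + c) * s ^ K := by ring

/-! ## §2 The top-scale piece as a multi-scale `NE5` inhabitant on Bałaban's tori, BY NAME -/

/-- **KING'S TOP-SCALE PIECE `G^η_{(K)} = C^η − G^η_K` AS A MULTI-SCALE INHABITANT OF N18's DECL OF RECORD — UNCONDITIONAL FOR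
KING'S ACTUAL OPERATORS ON BAŁABAN'S TORI.**  For `d ≥ 1`, odd `L > 1`, `a > 0`, `m² > 0`, `0 ≤ γ ≤ 1` there are `κ > 0`,
`C₅ ≥ 0` (functions of `d, L, a, m², γ` only) such that: for every `n ≥ 1`; every scale-indexed family of Bałaban unit
tori `L·M_K(μ) = 2L^{m_K}`; every carriers `C` with `1 ≤ scale X` whose domain `X` of scale `K` (run A's number of steps)
reads fine points `x_A(X)`, `y_A(X) ∈ T_η` (`η = L^{−K}`) UNDER `x_B(X)`, `y_B(X) ∈ T_{η′}` (`η′ = L^{−K−n}`) and has tree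
length at most `|B(x_A) − B(y_A)|_{T₁}`; every two functionals reading the top pieces — run A
`G^η_{(K)}(x_A, y_A) = topPiece (L^K) T₁ a_K L^{2K} m² x_A y_A`, run B `G^{η′}_{(K),(n)}(x_B, y_B)` (fineness `L^nL^K`,
coefficient `a_{K+n}`) — King's ACTUAL `A = 0` operators of the tree; every window: `NE5 EA EB W κ (L^{−γ∕2}) C₅`.  Proof:
`topPiece_rate_blocks` BY NAME at the volume `(d, L, m_K, K)`, then §1. [cite: King1986, p.675 (4.44)–(4.45), Prop. 3.9 p.665] -/
theorem ne5_kingModel_topPiece_torus (hd : 1 ≤ d) (L : ℕ) [NeZero L] (hLp : Odd L ∧ 1 < L) {a m2 : ℝ}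
    (ha : 0 < a) (hm : 0 < m2) {γ : ℝ} (hγ0 : 0 ≤ γ) (hγ1 : γ ≤ 1) :
    ∃ κ C₅ : ℝ, 0 < κ ∧ 0 ≤ C₅ ∧
      ∀ (n : ℕ) (_hn : 1 ≤ n) (M : ℕ → Fin d → ℕ) [∀ j μ, NeZero (M j μ)]
        (_hM : ∀ j, ∃ mm : ℕ, ∀ μ, L * M j μ = 2 * L ^ mm)
        (C : Carriers) (_hsc : ∀ X, 1 ≤ C.scale X)
        (xA yA : (X : C.Dom) → Tor (fine (L ^ C.scale X) (fine L (M (C.scale X)))))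
        (xB yB : (X : C.Dom) → Tor (fine (L ^ n * L ^ C.scale X) (fine L (M (C.scale X)))))
        (_hx : ∀ X μ, (xA X μ).val = (xB X μ).val / L ^ n)
        (_hy : ∀ X μ, (yA X μ).val = (yB X μ).val / L ^ n)
        (_hd : ∀ X, C.d X ≤ tdistT (fine L (M (C.scale X)))
            (blockOf (L ^ C.scale X) (fine L (M (C.scale X))) (xA X))
            (blockOf (L ^ C.scale X) (fine L (M (C.scale X))) (yA X)))
        (EA : Functional C C.BgA) (EB : Functional C C.BgB)
        (_hEA : ∀ g U X, EA g U X =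
          topPiece (L ^ C.scale X) (fine L (M (C.scale X))) (aK a L (C.scale X)) (((L ^ C.scale X : ℕ) : ℝ) ^ 2) m2
            (xA X) (yA X))
        (_hEB : ∀ g U X, EB g U X =
          topPiece (L ^ n * L ^ C.scale X) (fine L (M (C.scale X))) (aK a L (C.scale X + n))
            (((L ^ n * L ^ C.scale X : ℕ) : ℝ) ^ 2) m2 (xB X) (yB X))
        (W : Set (ℕ → ℝ)),
        NE5 EA EB W κ ((L : ℝ) ^ (-(γ / 2))) C₅ := by
  have hd0 : 0 < d := hd
  have hL2 : 2 ≤ L := by have := hLp.2; omega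
  obtain ⟨δ, c, hδ, hc, H⟩ := topPiece_rate_blocks d L hd hLp.1 hL2 ha hm hγ0 hγ1
  have hCu := prop38Const_unif_nonneg hd0 ha hL2 (by linarith : γ < 2)
  refine ⟨δ, c * Real.sqrt (prop38RateConst a a (a * (2 * ((a * (1 - ((L : ℝ) ^ 2)⁻¹))⁻¹ + π ^ 2 / 48 + 1 / 3)))
      ((π ^ 2 / 4) ^ d) d γ + prop38PosConst a ((π ^ 2 / 4) ^ d) d γ) + c, hδ, by positivity, ?_⟩
  intro n hn M _ hM C hsc xA yA xB yB hx hy hdd EA EB hEA hEB W g _ U X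
  rw [hEA, hEB, abs_sub_comm]
  obtain ⟨mm, hmm⟩ := hM (C.scale X)
  have hMK : ∀ μ, fine L (M (C.scale X)) μ
      = (⟨d, L, mm, C.scale X, hd, hLp⟩ : Params).sitesPerDir (C.scale X) := fun μ => by
    simp only [Params.sitesPerDir, Nat.add_sub_cancel]; exact hmm μ
  haveI : NeZero (⟨d, L, mm, C.scale X, hd, hLp⟩ : Params).L := ‹NeZero L›
  have h := H ⟨d, L, mm, C.scale X, hd, hLp⟩ rfl rfl (hsc X) n hn (fine L (M (C.scale X))) hMK
    (xA X) (yA X) (xB X) (yB X) (hx X) (hy X)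
  refine h.trans ?_
  have hfac := topRate_le_unif hd0 ha hL2 (hsc X) hn hγ1 hc.le (K := C.scale X) (n := n)
  have hexp : Real.exp (-(δ * tdistT (fine L (M (C.scale X)))
        (blockOf (L ^ C.scale X) (fine L (M (C.scale X))) (xA X))
        (blockOf (L ^ C.scale X) (fine L (M (C.scale X))) (yA X))))
      ≤ Real.exp (-(δ * C.d X)) :=
    Real.exp_le_exp.mpr (neg_le_neg (mul_le_mul_of_nonneg_left (hdd X) hδ.le))
  exact mul_le_mul hfac hexp (Real.exp_pos _).le (by positivity)

/-- The letters of §2 have CONTENT: `κ > 0` is delivered, and for `γ > 0` the rate `L^{−γ∕2}` lies in `]0, 1[`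
(`N18KingModelTorus.ne5_kingModel_threeFactor_letters`); the top piece's extra `(L^K)⁻¹` is a rate `< 1` even at `γ = 0`.
[cite: King1986, p.675] -/
theorem inv_pow_lt_one {L : ℕ} (hL : 2 ≤ L) {K : ℕ} (hK : 1 ≤ K) : ((L : ℝ) ^ K)⁻¹ < 1 := by
  have hLr : (1 : ℝ) < L := by exact_mod_cast (lt_of_lt_of_le one_lt_two hL)
  exact inv_lt_one_of_one_lt₀ (one_lt_pow₀ hLr (by omega))

/-! ## §3 The one-run envelopes of the top piece WITH `κ > 0` (the N10∕NODE-A face of the same graphs) -/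

/-- **Run A's top piece inhabits `DecayBound` with `κ > 0`**: `|G^η_{(K)}(x_A, y_A)| ≤ c·e^{−δ·d X}` at every domain of every
carriers as in §2 (`d X ≤ |B(x_A) − B(y_A)|_{T₁}`) — `topPiece_decay_blocks` (Prop. 3.7 for `G^η_{(K)}`) at the volume
`(d, L, m_K, K)`, ONE pair `δ, c` for all scales, tori and windows. [cite: King1986, p.675, Prop. 3.7 (3.64) p.663] -/
theorem decayBound_topPiece_A (hd : 1 ≤ d) (L : ℕ) [NeZero L] (hLp : Odd L ∧ 1 < L) {a m2 : ℝ} (ha : 0 < a)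
    (hm : 0 < m2) :
    ∃ δ c : ℝ, 0 < δ ∧ 0 < c ∧
      ∀ (M : ℕ → Fin d → ℕ) [∀ j μ, NeZero (M j μ)] (_hM : ∀ j, ∃ mm : ℕ, ∀ μ, L * M j μ = 2 * L ^ mm)
        (C : Carriers) (_hsc : ∀ X, 1 ≤ C.scale X)
        (xA yA : (X : C.Dom) → Tor (fine (L ^ C.scale X) (fine L (M (C.scale X)))))
        (_hd : ∀ X, C.d X ≤ tdistT (fine L (M (C.scale X)))
            (blockOf (L ^ C.scale X) (fine L (M (C.scale X))) (xA X))
            (blockOf (L ^ C.scale X) (fine L (M (C.scale X))) (yA X)))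
        (EA : Functional C C.BgA)
        (_hEA : ∀ g U X, EA g U X =
          topPiece (L ^ C.scale X) (fine L (M (C.scale X))) (aK a L (C.scale X)) (((L ^ C.scale X : ℕ) : ℝ) ^ 2) m2
            (xA X) (yA X))
        (W : Set (ℕ → ℝ)), DecayBound EA W c δ := by
  have hL2 : 2 ≤ L := by have := hLp.2; omega
  obtain ⟨δ, c, hδ, hc, H⟩ := topPiece_decay_blocks d L hd hLp.1 hL2 ha hm
  refine ⟨δ, c, hδ, hc, ?_⟩
  intro M _ hM C hsc xA yA hdd EA hEA W g _ U X
  rw [hEA]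
  obtain ⟨mm, hmm⟩ := hM (C.scale X)
  have hMK : ∀ μ, fine L (M (C.scale X)) μ
      = (⟨d, L, mm, C.scale X, hd, hLp⟩ : Params).sitesPerDir (C.scale X) := fun μ => by
    simp only [Params.sitesPerDir, Nat.add_sub_cancel]; exact hmm μ
  have h := H ⟨d, L, mm, C.scale X, hd, hLp⟩ rfl rfl (hsc X) (fine L (M (C.scale X))) hMK (L ^ C.scale X) rfl
    (xA X) (yA X)
  exact h.trans (mul_le_mul_of_nonneg_left
    (Real.exp_le_exp.mpr (neg_le_neg (mul_le_mul_of_nonneg_left (hdd X) hδ.le))) hc.le)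

/-- **Run B's top piece likewise** (`G^{η′}_{(K),(n)}(x_B, y_B)`, fineness `L^nL^K`, coefficient `a_{K+n}`; the volume
`(d, L, m_K, K + n)` has the same unit torus, and the blocks under `x_B, y_B` are `B(x_A), B(y_A)` — `blockOf_over`), for
every `n`. [cite: King1986, p.675, Prop. 3.7 (3.64) p.663] -/
theorem decayBound_topPiece_B (hd : 1 ≤ d) (L : ℕ) [NeZero L] (hLp : Odd L ∧ 1 < L) {a m2 : ℝ} (ha : 0 < a)
    (hm : 0 < m2) :
    ∃ δ c : ℝ, 0 < δ ∧ 0 < c ∧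
      ∀ (n : ℕ) (M : ℕ → Fin d → ℕ) [∀ j μ, NeZero (M j μ)] (_hM : ∀ j, ∃ mm : ℕ, ∀ μ, L * M j μ = 2 * L ^ mm)
        (C : Carriers) (_hsc : ∀ X, 1 ≤ C.scale X)
        (xA yA : (X : C.Dom) → Tor (fine (L ^ C.scale X) (fine L (M (C.scale X)))))
        (xB yB : (X : C.Dom) → Tor (fine (L ^ n * L ^ C.scale X) (fine L (M (C.scale X)))))
        (_hx : ∀ X μ, (xA X μ).val = (xB X μ).val / L ^ n)
        (_hy : ∀ X μ, (yA X μ).val = (yB X μ).val / L ^ n)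
        (_hd : ∀ X, C.d X ≤ tdistT (fine L (M (C.scale X)))
            (blockOf (L ^ C.scale X) (fine L (M (C.scale X))) (xA X))
            (blockOf (L ^ C.scale X) (fine L (M (C.scale X))) (yA X)))
        (EB : Functional C C.BgB)
        (_hEB : ∀ g U X, EB g U X =
          topPiece (L ^ n * L ^ C.scale X) (fine L (M (C.scale X))) (aK a L (C.scale X + n))
            (((L ^ n * L ^ C.scale X : ℕ) : ℝ) ^ 2) m2 (xB X) (yB X))
        (W : Set (ℕ → ℝ)), DecayBound EB W c δ := by
  have hL2 : 2 ≤ L := by have := hLp.2; omega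
  obtain ⟨δ, c, hδ, hc, H⟩ := topPiece_decay_blocks d L hd hLp.1 hL2 ha hm
  refine ⟨δ, c, hδ, hc, ?_⟩
  intro n M _ hM C hsc xA yA xB yB hx hy hdd EB hEB W g _ U X
  rw [hEB]
  obtain ⟨mm, hmm⟩ := hM (C.scale X)
  have hMK : ∀ μ, fine L (M (C.scale X)) μ
      = (⟨d, L, mm, C.scale X + n, hd, hLp⟩ : Params).sitesPerDir (C.scale X + n) := fun μ => by
    simp only [Params.sitesPerDir, Nat.add_sub_cancel]; exact hmm μ
  have hN : L ^ n * L ^ C.scale X = L ^ (C.scale X + n) := by rw [pow_add, mul_comm]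
  have h := H ⟨d, L, mm, C.scale X + n, hd, hLp⟩ rfl rfl (show 1 ≤ C.scale X + n by have := hsc X; omega)
    (fine L (M (C.scale X))) hMK (L ^ n * L ^ C.scale X) hN (xB X) (yB X)
  rw [blockOf_over (fine L (M (C.scale X))) (xA X) (xB X) (hx X),
    blockOf_over (fine L (M (C.scale X))) (yA X) (yB X) (hy X)] at h
  exact h.trans (mul_le_mul_of_nonneg_left
    (Real.exp_le_exp.mpr (neg_le_neg (mul_le_mul_of_nonneg_left (hdd X) hδ.le))) hc.le)

/-! ## §4 A LITERAL inhabitant: the top pieces on King's own carriers (`d X` = the block distance) -/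

/-- **§2 INHABITED IN THE KERNEL WITH `d X` = THE ACTUAL BLOCK DISTANCE.**  On the LITERAL carriers whose domains are a number
of steps `K` (creation scale `K + 1`) and a pair of run-B fine points `x′, y′ ∈ T_{η′}` (`η′ = L^{−K−1−n}`), with tree length
`d X := |B(x) − B(y)|_{T₁}` for the run-A points `x, y` under `x′, y′`, trivial backgrounds, transport `id`, gauge `0`, the two
functionals reading `G^η_{(K+1)}(x, y)` and `G^{η′}_{(K+1),(n)}(x′, y′)` satisfy `NE5 … κ (L^{−γ∕2}) C₅` with §2's letters for
EVERY `n ≥ 1`, every Bałaban unit torus `L·M′(μ) = 2L^{m}` and every window (`hx`, `hy` ≔ `coarse_val`, `hd` ≔ `le_rfl`, `hEA`,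
`hEB` ≔ `rfl`). [cite: King1986, p.675 (4.44), Prop. 3.9 p.665] -/
theorem ne5_kingModel_topPiece_inhabited (hd : 1 ≤ d) (L : ℕ) [NeZero L] (hLp : Odd L ∧ 1 < L) {a m2 : ℝ}
    (ha : 0 < a) (hm : 0 < m2) {γ : ℝ} (hγ0 : 0 ≤ γ) (hγ1 : γ ≤ 1) :
    ∃ κ C₅ : ℝ, 0 < κ ∧ 0 ≤ C₅ ∧
      ∀ (n : ℕ) (_hn : 1 ≤ n) (M' : Fin d → ℕ) [∀ μ, NeZero (M' μ)] (_hM' : ∃ mm : ℕ, ∀ μ, L * M' μ = 2 * L ^ mm)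
        (W : Set (ℕ → ℝ)),
        NE5 (C := { Dom := Σ K : ℕ, Tor (fine (L ^ n * L ^ (K + 1)) (fine L M'))
                                  × Tor (fine (L ^ n * L ^ (K + 1)) (fine L M')),
                    scale := fun X => X.1 + 1,
                    d := fun X => tdistT (fine L M')
                      (blockOf (L ^ (X.1 + 1)) (fine L M')
                        (fun μ => (((X.2.1 μ).val / L ^ n : ℕ) : ZMod (fine (L ^ (X.1 + 1)) (fine L M') μ))))
                      (blockOf (L ^ (X.1 + 1)) (fine L M')
                        (fun μ => (((X.2.2 μ).val / L ^ n : ℕ) : ZMod (fine (L ^ (X.1 + 1)) (fine L M') μ)))),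
                    d_nonneg := fun _ => tdistT_nonneg _ _ _,
                    BgA := PUnit, BgB := PUnit, gauge := fun _ _ => 0, gauge_nonneg := fun _ _ => le_rfl,
                    transport := id })
          (fun (_ : ℕ → ℝ) (_ : PUnit)
              (X : Σ K : ℕ, Tor (fine (L ^ n * L ^ (K + 1)) (fine L M')) × Tor (fine (L ^ n * L ^ (K + 1)) (fine L M'))) =>
            topPiece (L ^ (X.1 + 1)) (fine L M') (aK a L (X.1 + 1)) (((L ^ (X.1 + 1) : ℕ) : ℝ) ^ 2) m2
              (fun μ => (((X.2.1 μ).val / L ^ n : ℕ) : ZMod (fine (L ^ (X.1 + 1)) (fine L M') μ)))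
              (fun μ => (((X.2.2 μ).val / L ^ n : ℕ) : ZMod (fine (L ^ (X.1 + 1)) (fine L M') μ))))
          (fun (_ : ℕ → ℝ) (_ : PUnit)
              (X : Σ K : ℕ, Tor (fine (L ^ n * L ^ (K + 1)) (fine L M')) × Tor (fine (L ^ n * L ^ (K + 1)) (fine L M'))) =>
            topPiece (L ^ n * L ^ (X.1 + 1)) (fine L M') (aK a L (X.1 + 1 + n))
              (((L ^ n * L ^ (X.1 + 1) : ℕ) : ℝ) ^ 2) m2 X.2.1 X.2.2)
          W κ ((L : ℝ) ^ (-(γ / 2))) C₅ := by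
  obtain ⟨κ, C₅, hκ, hC₅, H⟩ := ne5_kingModel_topPiece_torus hd L hLp ha hm hγ0 hγ1
  refine ⟨κ, C₅, hκ, hC₅, ?_⟩
  intro n hn M' _ hM' W
  have hLn : 0 < L ^ n := pow_pos (Nat.pos_of_ne_zero (NeZero.ne L)) n
  -- the carriers literal is repeated so that the reading maps elaborate against a closed structure
  exact H n hn (fun _ => M') (fun _ => hM')
    { Dom := Σ K : ℕ, Tor (fine (L ^ n * L ^ (K + 1)) (fine L M')) × Tor (fine (L ^ n * L ^ (K + 1)) (fine L M')),
      scale := fun X => X.1 + 1,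
      d := fun X => tdistT (fine L M')
        (blockOf (L ^ (X.1 + 1)) (fine L M')
          (fun μ => (((X.2.1 μ).val / L ^ n : ℕ) : ZMod (fine (L ^ (X.1 + 1)) (fine L M') μ))))
        (blockOf (L ^ (X.1 + 1)) (fine L M')
          (fun μ => (((X.2.2 μ).val / L ^ n : ℕ) : ZMod (fine (L ^ (X.1 + 1)) (fine L M') μ)))),
      d_nonneg := fun _ => tdistT_nonneg _ _ _,
      BgA := PUnit, BgB := PUnit, gauge := fun _ _ => 0, gauge_nonneg := fun _ _ => le_rfl, transport := id }
    (fun _ => Nat.succ_le_succ (Nat.zero_le _))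
    (fun X μ => (((X.2.1 μ).val / L ^ n : ℕ) : ZMod (fine (L ^ (X.1 + 1)) (fine L M') μ)))
    (fun X μ => (((X.2.2 μ).val / L ^ n : ℕ) : ZMod (fine (L ^ (X.1 + 1)) (fine L M') μ)))
    (fun X => X.2.1) (fun X => X.2.2)
    (fun X μ => coarse_val hLn X.2.1 μ) (fun X μ => coarse_val hLn X.2.2 μ)
    (fun _ => le_rfl) _ _ (fun _ _ _ => rfl) (fun _ _ _ => rfl) W

end Summit.QuantumFields.YangMills.BalabanUVNodes.N18KingModelTopPiece

end
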